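import Mathlib
import Summits.Ventures.PercRepro2.K5Kernel
import Summits.Ventures.PercRepro2.K5Kron

/-!
# From the kernel certificates to the coefficient inequalities
(blind cell PercRepro2, typer-1 g9; third bridge file of the `K₅` certificate)

The kernel facts `K5.cert_ii` / `K5.cert_i` (`K5Kernel.lean`) are statements about the three integers
`kNeg ≤ kPos`, `Nat.land (kPos − kNeg) mask = 0`, `Nat.land kNeg mask = 0`.  With the Kronecker identity
`kPos = Σ_k cntPos k · KB^{idx4 k}` (`K5Kron.lean`: `cntPos k = cnt3 ABO Q PD k + cnt3 QB PDoU A k`, the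
number of positive triples of profile `k`) and `kNeg = Σ_k cntNeg k · KB^{idx4 k}`, this file reads the
coefficients off the digits:

* `digit_sum`: the base-`B` digits of `Σ_{j<m} a_j B^j` with `a_j < B` are the `a_j` (and the sum is `< B^m`);
* `digit_lt_of_land_mask`: `Nat.land X mask = 0` forces every base-`KB` digit of `X` below `2^19`
  (bit `19` of the digit is bit `20j + 19` of `X`, which the mask tests);
* hence with `D = kPos − kNeg`: `kPos = D + kNeg` digit by digit — the digits of `D` are `< 2^19` (mask),
  the digits of `kNeg` are the counts `cntNeg ≤ 2·3^10 < 2^19`, so there is no carry and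
  `cntPos k = d_k + cntNeg k ≥ cntNeg k` for every profile `k` (`cntNeg_le_cntPos`); likewise
  `cntPos₁ k ≤ cntNeg₁ k` for (i) (`cntPos₁_le_cntNeg₁`).
-/

namespace Summit.Ventures.PercRepro2

namespace K5

/-! ## Digits of a base-`B` sum -/

section Digits

/-- A base-`B` sum with digits `< B` is `< B^m`. -/
lemma sum_lt_pow {B : ℕ} (hB : 2 ≤ B) (a : ℕ → ℕ) :
    ∀ m : ℕ, (∀ j < m, a j < B) → ∑ j ∈ Finset.range m, a j * B ^ j < B ^ m
  | 0, _ => by simp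
  | m + 1, ha => by
    rw [Finset.sum_range_succ, pow_succ]
    have ih := sum_lt_pow hB a m fun j hj => ha j (by omega)
    have hm := ha m (by omega)
    have hBpos : 0 < B ^ m := pow_pos (by omega) m
    -- `S + a_m B^m ≤ (B^m − 1) + (B − 1) B^m = B^m · B − 1`
    have h1 : ∑ j ∈ Finset.range m, a j * B ^ j + 1 ≤ B ^ m := ih
    have h2 : a m + 1 ≤ B := hm
    nlinarith [Nat.mul_le_mul_right (B ^ m) h2]

/-- **The digits of a base-`B` sum**: `(Σ_{j<m} a_j B^j) / B^i % B = a_i` for `i < m` when all `a_j < B`. -/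
theorem digit_sum {B : ℕ} (hB : 2 ≤ B) (a : ℕ → ℕ) :
    ∀ m : ℕ, (∀ j < m, a j < B) → ∀ i < m, (∑ j ∈ Finset.range m, a j * B ^ j) / B ^ i % B = a i
  | 0, _, i, hi => absurd hi (Nat.not_lt_zero i)
  | m + 1, ha, i, hi => by
    have hBpos : 0 < B := by omega
    rw [Finset.sum_range_succ]
    rcases Nat.lt_succ_iff_lt_or_eq.1 hi with hi | rfl
    · -- `i < m`: the top term `a_m B^m = B^i · (a_m B^{m-i})` with `m - i ≥ 1` is a multiple of `B^{i+1}`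
      have ih := digit_sum hB a m (fun j hj => ha j (by omega)) i hi
      have hdiv : B ^ (i + 1) ∣ a m * B ^ m :=
        Dvd.dvd.mul_left (pow_dvd_pow B (by omega)) _
      obtain ⟨c, hc⟩ := hdiv
      rw [hc, pow_succ, mul_assoc, mul_comm (B ^ i), Nat.add_mul_div_right _ _ (pow_pos hBpos i),
        Nat.add_mul_mod_self_left]
      exact ih
    · -- `i = m`: the lower sum is `< B^i` and the top term contributes `a_i`
      have hlt := sum_lt_pow hB a i fun j hj => ha j (by omega)
      rw [Nat.add_mul_div_right _ _ (pow_pos hBpos i), Nat.div_eq_of_lt hlt, zero_add]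
      exact Nat.mod_eq_of_lt (ha i (by omega))

end Digits

/-! ## The mask reads bit `19` of every digit -/

section Mask

/-- `KB = 2^20`. -/
lemma KB_eq : KB = 2 ^ 20 := rfl

/-- `KB^j = 2^(20 j)`. -/
lemma KB_pow (j : ℕ) : KB ^ j = 2 ^ (20 * j) := by
  rw [KB_eq, ← pow_mul]

/-- The scaled geometric sum, for any length `m` (keeping `m` abstract keeps the elaborator from
evaluating `Finset.range (4^10)`). -/
lemma scaled_geomSum (m : ℕ) :
    2 ^ 19 * ((KB ^ m - 1) / (KB - 1)) = ∑ j ∈ Finset.range m, 2 ^ 19 * KB ^ j := by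
  rw [← Nat.geomSum_eq (by rw [KB_eq]; norm_num) m]
  exact Finset.mul_sum _ _ _

/-- The mask is `Σ_{j < 4^10} 2^19 · KB^j`. -/
lemma mask_eq : mask = ∑ j ∈ Finset.range (4 ^ 10), 2 ^ 19 * KB ^ j := scaled_geomSum (4 ^ 10)

/-- Every base-`KB` digit of the mask is `2^19`. -/
lemma mask_digit {j : ℕ} (hj : j < 4 ^ 10) : mask / KB ^ j % KB = 2 ^ 19 := by
  rw [mask_eq]
  exact digit_sum (B := KB) (by rw [KB_eq]; norm_num) (fun _ => 2 ^ 19) (4 ^ 10)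
    (fun _ _ => by rw [KB_eq]; norm_num) j hj

/-- Bit `19` of the base-`KB` digit `j` of `X` is the bit `20 j + 19` of `X`. -/
lemma testBit_digit (X j : ℕ) :
    X.testBit (20 * j + 19) = decide ((X / KB ^ j % KB) / 2 ^ 19 = 1) := by
  rw [Nat.testBit_eq_decide_div_mod_eq, KB_pow, KB_eq]
  congr 1
  have h1 : X / 2 ^ (20 * j + 19) = X / 2 ^ (20 * j) / 2 ^ 19 := by
    rw [Nat.div_div_eq_div_mul, ← pow_add]
  have h2 : X / 2 ^ (20 * j) % 2 ^ 20 / 2 ^ 19 = X / 2 ^ (20 * j) / 2 ^ 19 % 2 := by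
    rw [show (2 : ℕ) ^ 20 = 2 ^ 19 * 2 from by norm_num, Nat.mod_mul_right_div_self]
  rw [h1, h2]

/-- Bit `20 j + 19` of the mask is set for `j < 4^10`. -/
lemma mask_testBit {j : ℕ} (hj : j < 4 ^ 10) : mask.testBit (20 * j + 19) = true := by
  rw [testBit_digit, mask_digit hj, Nat.div_self (by norm_num), decide_eq_true_iff]

/-- **The mask test bounds the digits**: `Nat.land X mask = 0` forces every base-`KB` digit of `X` below
`2^19`. -/
theorem digit_lt_of_land_mask {X : ℕ} (h : Nat.land X mask = 0) {j : ℕ} (hj : j < 4 ^ 10) :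
    X / KB ^ j % KB < 2 ^ 19 := by
  have hbit : X.testBit (20 * j + 19) = false := by
    change X &&& mask = 0 at h
    have := congrArg (fun n => n.testBit (20 * j + 19)) h
    simp only [Nat.testBit_land, Nat.zero_testBit] at this
    rwa [mask_testBit hj, Bool.and_true] at this
  rw [testBit_digit, decide_eq_false_iff_not] at hbit
  have hlt : X / KB ^ j % KB < KB := Nat.mod_lt _ (by rw [KB_eq]; norm_num)
  rw [KB_eq] at hlt
  have hq : X / KB ^ j % KB / 2 ^ 19 < 2 := by
    rw [Nat.div_lt_iff_lt_mul (by norm_num)]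
    calc X / KB ^ j % KB < 2 ^ 20 := hlt
      _ = 2 * 2 ^ 19 := by norm_num
  have hq0 : X / KB ^ j % KB / 2 ^ 19 = 0 := by omega
  rwa [Nat.div_eq_zero_iff_lt (by norm_num)] at hq0

end Mask

/-! ## The coefficient inequalities -/

section Coefficients

/-- The positive triple counts of the cleared (ii). -/
def cntPos (k : Fin 10 → Fin 4) : ℕ := cnt3 tABO tQ tPD k + cnt3 tQB tPDoU tA k

/-- The negative triple counts of the cleared (ii). -/
def cntNeg (k : Fin 10 → Fin 4) : ℕ := cnt3 tQB tAO tPD k + cnt3 tAB tPDoU tQ k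

/-- The positive triple counts of the cleared (i). -/
def cntPos₁ (k : Fin 10 → Fin 4) : ℕ := cnt3 tABOL tQ tPD k + cnt3 tQBL tPDoU tA k

/-- The negative triple counts of the cleared (i). -/
def cntNeg₁ (k : Fin 10 → Fin 4) : ℕ := cnt3 tQBL tAO tPD k + cnt3 tABL tPDoU tQ k

/-- Two Kronecker sums combine (stated with the coefficient functions as VARIABLES: instantiating a
generic sum lemma directly at `cnt3`-terms makes the kernel try to evaluate `cnt3` — a sum over `2^30`
triples — and run out of memory; with `f, g` abstract the instantiation is a plain application). -/
lemma sum_add_mul5 (f g : (Fin 10 → Fin 4) → ℕ) :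
    ∑ k, f k * KB ^ idx4 k + ∑ k, g k * KB ^ idx4 k = ∑ k, (f k + g k) * KB ^ idx4 k := by
  rw [← Finset.sum_add_distrib]
  exact Finset.sum_congr rfl fun k _ => (add_mul _ _ _).symm

/-- `kPos` carries the positive counts. -/
lemma kPos_eq : kPos = ∑ k, cntPos k * KB ^ idx4 k :=
  calc kPos = kronSum tABO * kronSum tQ * kronSum tPD + kronSum tQB * kronSum tPDoU * kronSum tA := by
        unfold kPos
        rw [kron_eq_kronSum tABO, kron_eq_kronSum tQ, kron_eq_kronSum tPD, kron_eq_kronSum tQB,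
          kron_eq_kronSum tPDoU, kron_eq_kronSum tA]
    _ = ∑ k, cnt3 tABO tQ tPD k * KB ^ idx4 k + ∑ k, cnt3 tQB tPDoU tA k * KB ^ idx4 k :=
        congrArg₂ (· + ·) (kronSum_mul_mul _ _ _) (kronSum_mul_mul _ _ _)
    _ = ∑ k, cntPos k * KB ^ idx4 k := sum_add_mul5 _ _

/-- `kNeg` carries the negative counts. -/
lemma kNeg_eq : kNeg = ∑ k, cntNeg k * KB ^ idx4 k :=
  calc kNeg = kronSum tQB * kronSum tAO * kronSum tPD + kronSum tAB * kronSum tPDoU * kronSum tQ := by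
        unfold kNeg
        rw [kron_eq_kronSum tQB, kron_eq_kronSum tAO, kron_eq_kronSum tPD, kron_eq_kronSum tAB,
          kron_eq_kronSum tPDoU, kron_eq_kronSum tQ]
    _ = ∑ k, cnt3 tQB tAO tPD k * KB ^ idx4 k + ∑ k, cnt3 tAB tPDoU tQ k * KB ^ idx4 k :=
        congrArg₂ (· + ·) (kronSum_mul_mul _ _ _) (kronSum_mul_mul _ _ _)
    _ = ∑ k, cntNeg k * KB ^ idx4 k := sum_add_mul5 _ _

/-- `kPos₁` carries the positive counts of (i). -/
lemma kPos₁_eq : kPos₁ = ∑ k, cntPos₁ k * KB ^ idx4 k :=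
  calc kPos₁ = kronSum tABOL * kronSum tQ * kronSum tPD + kronSum tQBL * kronSum tPDoU * kronSum tA := by
        unfold kPos₁
        rw [kron_eq_kronSum tABOL, kron_eq_kronSum tQ, kron_eq_kronSum tPD, kron_eq_kronSum tQBL,
          kron_eq_kronSum tPDoU, kron_eq_kronSum tA]
    _ = ∑ k, cnt3 tABOL tQ tPD k * KB ^ idx4 k + ∑ k, cnt3 tQBL tPDoU tA k * KB ^ idx4 k :=
        congrArg₂ (· + ·) (kronSum_mul_mul _ _ _) (kronSum_mul_mul _ _ _)
    _ = ∑ k, cntPos₁ k * KB ^ idx4 k := sum_add_mul5 _ _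

/-- `kNeg₁` carries the negative counts of (i). -/
lemma kNeg₁_eq : kNeg₁ = ∑ k, cntNeg₁ k * KB ^ idx4 k :=
  calc kNeg₁ = kronSum tQBL * kronSum tAO * kronSum tPD + kronSum tABL * kronSum tPDoU * kronSum tQ := by
        unfold kNeg₁
        rw [kron_eq_kronSum tQBL, kron_eq_kronSum tAO, kron_eq_kronSum tPD, kron_eq_kronSum tABL,
          kron_eq_kronSum tPDoU, kron_eq_kronSum tQ]
    _ = ∑ k, cnt3 tQBL tAO tPD k * KB ^ idx4 k + ∑ k, cnt3 tABL tPDoU tQ k * KB ^ idx4 k :=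
        congrArg₂ (· + ·) (kronSum_mul_mul _ _ _) (kronSum_mul_mul _ _ _)
    _ = ∑ k, cntNeg₁ k * KB ^ idx4 k := sum_add_mul5 _ _

/-- A sum over the profiles re-indexed over `range (4^10)` through `decode4`. -/
lemma sum_profiles_eq (c : (Fin 10 → Fin 4) → ℕ) :
    ∑ k, c k * KB ^ idx4 k = ∑ j ∈ Finset.range (4 ^ 10), c (decode4 j) * KB ^ j := by
  refine Finset.sum_nbij' idx4 decode4 (fun k _ => ?_) (fun j _ => Finset.mem_univ _)
    (fun k _ => decode4_idx4 k) (fun j hj => ?_) (fun k _ => ?_)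
  · exact Finset.mem_range.2 (idx4_lt k)
  · exact idx4_decode4 (Finset.mem_range.1 hj)
  · rw [decode4_idx4]

/-- The counts are bounded by `2 · 3^10 < 2^19`. -/
lemma cntPos_lt (k : Fin 10 → Fin 4) : cntPos k < 2 ^ 19 := by
  unfold cntPos
  have := cnt3_le tABO tQ tPD k
  have := cnt3_le tQB tPDoU tA k
  omega

/-- The counts are bounded by `2 · 3^10 < 2^19`. -/
lemma cntNeg_lt (k : Fin 10 → Fin 4) : cntNeg k < 2 ^ 19 := by
  unfold cntNeg
  have := cnt3_le tQB tAO tPD k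
  have := cnt3_le tAB tPDoU tQ k
  omega

/-- The counts are bounded by `2 · 3^10 < 2^19`. -/
lemma cntPos₁_lt (k : Fin 10 → Fin 4) : cntPos₁ k < 2 ^ 19 := by
  unfold cntPos₁
  have := cnt3_le tABOL tQ tPD k
  have := cnt3_le tQBL tPDoU tA k
  omega

/-- The counts are bounded by `2 · 3^10 < 2^19`. -/
lemma cntNeg₁_lt (k : Fin 10 → Fin 4) : cntNeg₁ k < 2 ^ 19 := by
  unfold cntNeg₁
  have := cnt3_le tQBL tAO tPD k
  have := cnt3_le tABL tPDoU tQ k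
  omega

/-- **Base-`B` expansion**: a number below `B^m` is the sum of its `m` lowest digits. -/
theorem expand_digits {B : ℕ} (hB : 2 ≤ B) :
    ∀ m : ℕ, ∀ X < B ^ m, X = ∑ j ∈ Finset.range m, X / B ^ j % B * B ^ j
  | 0, X, hX => by simp at hX; simp [hX]
  | m + 1, X, hX => by
    have hBpos : 0 < B := by omega
    rw [Finset.sum_range_succ]
    have ih := expand_digits hB m (X % B ^ m) (Nat.mod_lt _ (pow_pos hBpos m))
    have h2 : ∀ j < m, X % B ^ m / B ^ j % B = X / B ^ j % B := by
      intro j hj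
      have : B ^ m = B ^ j * B ^ (m - j) := by rw [← pow_add]; congr 1; omega
      rw [this, Nat.mod_mul_right_div_self, Nat.mod_mod_of_dvd _ (dvd_pow_self B (by omega))]
    have htop : X / B ^ m % B = X / B ^ m := by
      apply Nat.mod_eq_of_lt
      rw [Nat.div_lt_iff_lt_mul (pow_pos hBpos m), mul_comm, ← pow_succ]
      exact hX
    calc X = X % B ^ m + B ^ m * (X / B ^ m) := (Nat.mod_add_div X (B ^ m)).symm
      _ = ∑ j ∈ Finset.range m, X / B ^ j % B * B ^ j + X / B ^ m % B * B ^ m := by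
        rw [htop, mul_comm (B ^ m)]
        congr 1
        rw [ih]
        exact Finset.sum_congr rfl fun j hj => by rw [h2 j (Finset.mem_range.1 hj)]

/-- **The digit argument**, abstractly: if `P = Σ_k a k KB^{idx4 k}`, `M = Σ_k b k KB^{idx4 k}` with
`a, b < 2^19`, `M ≤ P` and `Nat.land (P − M) mask = 0`, then `b k ≤ a k` for every profile `k`. -/
theorem le_of_kron_le (a b : (Fin 10 → Fin 4) → ℕ) (ha : ∀ k, a k < 2 ^ 19) (hb : ∀ k, b k < 2 ^ 19)
    {P M : ℕ} (hP : P = ∑ k, a k * KB ^ idx4 k) (hM : M = ∑ k, b k * KB ^ idx4 k) (hle : M ≤ P)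
    (hmask : Nat.land (P - M) mask = 0) (k : Fin 10 → Fin 4) : b k ≤ a k := by
  have hKB : 2 ≤ KB := by rw [KB_eq]; norm_num
  have h19 : (2 : ℕ) ^ 19 < KB := by rw [KB_eq]; norm_num
  set D := P - M with hD
  have hDM : P = D + M := by omega
  -- the digits of `D`
  have hdlt : ∀ j < 4 ^ 10, D / KB ^ j % KB < 2 ^ 19 := fun j hj => digit_lt_of_land_mask hmask hj
  have hPlt : P < KB ^ (4 ^ 10) := by
    rw [hP, sum_profiles_eq]
    exact sum_lt_pow hKB _ _ fun j _ => lt_trans (ha _) h19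
  have hDlt : D < KB ^ (4 ^ 10) := by omega
  have hDsum := expand_digits hKB (4 ^ 10) D hDlt
  -- `P` as the sum of `d_j + b_j`
  have hPsum : P = ∑ j ∈ Finset.range (4 ^ 10), (D / KB ^ j % KB + b (decode4 j)) * KB ^ j := by
    rw [hDM, hM, sum_profiles_eq]
    conv_lhs => rw [hDsum]
    rw [← Finset.sum_add_distrib]
    exact Finset.sum_congr rfl fun j _ => by ring
  -- digit `idx4 k` of `P`, read both ways
  have hj : idx4 k < 4 ^ 10 := idx4_lt k
  have h1 : P / KB ^ idx4 k % KB = a k := by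
    rw [hP, sum_profiles_eq]
    rw [digit_sum hKB (fun j => a (decode4 j)) (4 ^ 10) (fun j _ => lt_trans (ha _) h19) (idx4 k) hj,
      decode4_idx4]
  have h2 : P / KB ^ idx4 k % KB = D / KB ^ idx4 k % KB + b k := by
    rw [hPsum]
    rw [digit_sum hKB (fun j => D / KB ^ j % KB + b (decode4 j)) (4 ^ 10)
      (fun j hj' => by
        have := hdlt j hj'; have := hb (decode4 j)
        have h2 : (2 : ℕ) ^ 19 + 2 ^ 19 = KB := by rw [KB_eq]; norm_num
        omega) (idx4 k) hj,
      decode4_idx4]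
  have e : a k = D / KB ^ idx4 k % KB + b k := h1.symm.trans h2
  rw [e]
  exact Nat.le_add_left _ _

/-- **Every Bernstein coefficient of the cleared (ii) is `≥ 0`**: `cntNeg k ≤ cntPos k`. -/
theorem cntNeg_le_cntPos (k : Fin 10 → Fin 4) : cntNeg k ≤ cntPos k :=
  le_of_kron_le cntPos cntNeg cntPos_lt cntNeg_lt kPos_eq kNeg_eq cert_ii.1 cert_ii.2.1 k

/-- **Every Bernstein coefficient of the cleared (i) is `≤ 0`**: `cntPos₁ k ≤ cntNeg₁ k`. -/
theorem cntPos₁_le_cntNeg₁ (k : Fin 10 → Fin 4) : cntPos₁ k ≤ cntNeg₁ k :=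
  le_of_kron_le cntNeg₁ cntPos₁ cntNeg₁_lt cntPos₁_lt kNeg₁_eq kPos₁_eq cert_i.1 cert_i.2.1 k

end Coefficients

end K5

end Summit.Ventures.PercRepro2
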